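import Summits.NavierStokesRegularity.NavierStokesRegularity.Theses.TypeIQuarterGate
import Summits.NavierStokesRegularity.NavierStokesRegularity.Theorems.TypeICertificateLadderRungReynoldsOneTaoCover
import Literature.Analysis.FluidPDE.ElgindiBlowup
import HarnessLib

/-!
# `TypeIQuarterGate`: the quarter law localises at the blow-up time

Helper for the crux `QuarterLawTypeI` (stmt-NavierStokesRegularity-23726): its conclusion
`∃ K, ∀ t ∈ [0,T), ∫‖curl u(t)‖² ≤ K/√(T−t)` is stated on ALL of `[0,T)`, so besides Leray's rate near
`T` it asserts bounded enstrophy on every `[0, T−δ]` (refuter note on the item, 2026-08-28: «the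
conclusion is on ALL of Ico 0 T … delivered only through eventual regularity + bounded-velocity Sobolev
facts — mathematically true, Lean-heavy; an eventual form would carry the route with less burden»).
This file discharges that burden once and for all:

* `lintegral_curl_sq_le_of_sobolev` — `∫‖curl v‖ₑ² ≤ 16 ∫‖D v‖ₑ²` (pointwise `‖curl v‖ ≤ 4‖Dv‖`, tree
  `norm_curl_le_four_mul`), so a Sobolev bound of order `1` bounds the enstrophy;
* `quarterLaw_of_eventually` — for a classical solution on `[0,T)` (`ν > 0`), Leray–Hopf from its rapidly
  decaying datum, the quarter law on a final window `[t₀,T)` extends to `[0,T)`: on `[0,t₀]` Tao's class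
  (tree: `RungReynoldsOne.stub_taoCover`) bounds `∫‖Du(t)‖²`, hence the enstrophy, by a constant
  `Z₀ ≤ Z₀√T/√(T−t)`;
* by name: `quarterLawTypeI_of_eventual` — the EVENTUAL quarter law (same hypotheses, conclusion
  `∃ K t₀, t₀ < T ∧ ∀ t ∈ [t₀,T), …`) implies `QuarterLawTypeI`; `eventual_of_quarterLawTypeI` is the
  trivial converse.  So the open content of 23726 is exactly Leray's upper rate AT `T`.

HONEST FRAMING: bookkeeping along a HYPOTHETICAL blow-up; `QuarterLawTypeI` remains OPEN; nothing about
Navier–Stokes regularity or blow-up is claimed. [cite: Tao2011, Thm. 5.4 (i)+(iv)] [folklore]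
-/

-- the problem directory repeats the summit name (`NavierStokesRegularity/NavierStokesRegularity`)
set_option linter.dupNamespace false

noncomputable section

open Set Filter MeasureTheory Topology Metric
open scoped ENNReal NNReal

namespace Summit.NavierStokesRegularity.NavierStokesRegularity.Theorems

namespace LorentzOfEnvelope

open Literature.Analysis.FluidPDE

/-! ### Enstrophy from a first-order Sobolev bound -/

/-- `∫ ‖curl v‖ₑ² ≤ 16 ∫ ‖D v‖ₑ²` (pointwise `‖curl v(x)‖ ≤ 4 ‖Dv(x)‖`, with `‖Dv(x)‖ = ‖D¹v(x)‖`).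
[folklore] -/
theorem lintegral_curl_sq_le_of_sobolev (v : EuclideanSpace ℝ (Fin 3) → EuclideanSpace ℝ (Fin 3)) :
    ∫⁻ x, ‖curl v x‖ₑ ^ 2 ≤ 16 * ∫⁻ x, ‖iteratedFDeriv ℝ 1 v x‖ₑ ^ 2 := by
  rw [← lintegral_const_mul' _ _ (by norm_num)]
  refine lintegral_mono fun x => ?_
  have h4 : ‖curl v x‖ ≤ 4 * ‖iteratedFDeriv ℝ 1 v x‖ := by
    rw [norm_iteratedFDeriv_one]; exact norm_curl_le_four_mul v x
  have h16 : (16 : ℝ≥0∞) = ENNReal.ofReal (4 ^ 2) := by norm_num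
  rw [← ofReal_norm, ← ofReal_norm, ← ENNReal.ofReal_pow (norm_nonneg _),
    ← ENNReal.ofReal_pow (norm_nonneg _), h16, ← ENNReal.ofReal_mul (by norm_num)]
  refine ENNReal.ofReal_le_ofReal ?_
  nlinarith [norm_nonneg (curl v x), norm_nonneg (iteratedFDeriv ℝ 1 v x)]

/-! ### The early times are free: eventual ⟹ global -/

/-- **The quarter law localises at `T`.** For a classical solution of the unforced system on `[0,T)`
(`ν > 0`), Leray–Hopf from its rapidly decaying datum, Leray's upper rate on a final window `[t₀,T)`
extends to `[0,T)`: before `t₀` the solution is in Tao's class (all Sobolev norms bounded), hence has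
bounded enstrophy `Z₀`, and `Z₀ ≤ Z₀√T/√(T−t)`. [cite: Tao2011, Thm. 5.4 (i)+(iv)] -/
theorem quarterLaw_of_eventually {ν T : ℝ} (hν : 0 < ν) (hT : 0 < T)
    {u : ℝ → EuclideanSpace ℝ (Fin 3) → EuclideanSpace ℝ (Fin 3)}
    {p : ℝ → EuclideanSpace ℝ (Fin 3) → ℝ}
    (hsol : IsClassicalNSSolutionOn (Ico 0 T) ν 0 u p) (hLH : IsLerayHopfOn T ν 0 (u 0) u)
    (hdec : HasRapidSpatialDecay (u 0))
    (hev : ∃ K t₀ : ℝ, t₀ < T ∧ ∀ t ∈ Ico t₀ T,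
      ∫⁻ x, ‖curl (u t) x‖ₑ ^ 2 ≤ ENNReal.ofReal (K / Real.sqrt (T - t))) :
    ∃ K : ℝ, ∀ t ∈ Ico 0 T,
      ∫⁻ x, ‖curl (u t) x‖ₑ ^ 2 ≤ ENNReal.ofReal (K / Real.sqrt (T - t)) := by
  obtain ⟨K, t₀, ht₀T, hK⟩ := hev
  rcases le_or_gt t₀ 0 with ht₀ | ht₀
  · exact ⟨K, fun t ht => hK t ⟨ht₀.trans ht.1, ht.2⟩⟩
  -- `0 < t₀ < T`: Tao's class on `[0, t₀]`, Sobolev bound of order `1`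
  obtain ⟨q, -, hB, -, -⟩ := RungReynoldsOne.stub_taoCover hν hT hsol hLH hdec ⟨ht₀, ht₀T⟩
  obtain ⟨C₁, hC₁⟩ := hB 1
  set Z₀ : ℝ := 16 * (C₁ : ℝ) with hZ₀_def
  have hZ₀ : 0 ≤ Z₀ := by positivity
  refine ⟨max K (Z₀ * Real.sqrt T), fun t ht => ?_⟩
  have hst : 0 < Real.sqrt (T - t) := Real.sqrt_pos.2 (by linarith [ht.2])
  rcases lt_or_ge t t₀ with htt₀ | htt₀
  · -- early time: `Z(t) ≤ 16 C₁ = Z₀ ≤ Z₀ √T/√(T−t) ≤ max(…)/√(T−t)`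
    have h1 := lintegral_curl_sq_le_of_sobolev (u t)
    have h2 : ∫⁻ x, ‖iteratedFDeriv ℝ 1 (u t) x‖ₑ ^ 2 ≤ C₁ := hC₁ t ⟨ht.1, htt₀.le⟩
    have h3 : ∫⁻ x, ‖curl (u t) x‖ₑ ^ 2 ≤ ENNReal.ofReal Z₀ := by
      refine h1.trans ?_
      rw [hZ₀_def, ENNReal.ofReal_mul (by norm_num), ENNReal.ofReal_coe_nnreal,
        show ENNReal.ofReal 16 = 16 by norm_num]
      exact mul_le_mul' le_rfl h2
    refine h3.trans (ENNReal.ofReal_le_ofReal ?_)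
    rw [le_div_iff₀ hst]
    have hsT : Real.sqrt (T - t) ≤ Real.sqrt T := Real.sqrt_le_sqrt (by linarith [ht.1])
    calc Z₀ * Real.sqrt (T - t) ≤ Z₀ * Real.sqrt T := mul_le_mul_of_nonneg_left hsT hZ₀
      _ ≤ max K (Z₀ * Real.sqrt T) := le_max_right _ _
  · refine (hK t ⟨htt₀, ht.2⟩).trans (ENNReal.ofReal_le_ofReal ?_)
    exact div_le_div_of_nonneg_right (le_max_left _ _) hst.le

/-- **The quarter law on `[0,T)` ⟺ its eventual form at `T`**, along any classical solution on
`[0,T)` that is Leray–Hopf from a rapidly decaying datum (`ν, T > 0`). [folklore] -/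
theorem quarterLaw_iff_eventually {ν T : ℝ} (hν : 0 < ν) (hT : 0 < T)
    {u : ℝ → EuclideanSpace ℝ (Fin 3) → EuclideanSpace ℝ (Fin 3)}
    {p : ℝ → EuclideanSpace ℝ (Fin 3) → ℝ}
    (hsol : IsClassicalNSSolutionOn (Ico 0 T) ν 0 u p) (hLH : IsLerayHopfOn T ν 0 (u 0) u)
    (hdec : HasRapidSpatialDecay (u 0)) :
    (∃ K : ℝ, ∀ t ∈ Ico 0 T,
        ∫⁻ x, ‖curl (u t) x‖ₑ ^ 2 ≤ ENNReal.ofReal (K / Real.sqrt (T - t))) ↔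
      ∃ K t₀ : ℝ, t₀ < T ∧ ∀ t ∈ Ico t₀ T,
        ∫⁻ x, ‖curl (u t) x‖ₑ ^ 2 ≤ ENNReal.ofReal (K / Real.sqrt (T - t)) :=
  ⟨fun ⟨K, h⟩ => ⟨K, 0, hT, h⟩, quarterLaw_of_eventually hν hT hsol hLH hdec⟩

/-! ### By name -/

open Summit.NavierStokesRegularity.NavierStokesRegularity.Theses.TypeIQuarterGate in
/-- **`QuarterLawTypeI` (23726) follows from its EVENTUAL form at the blow-up time**: it suffices
to prove Leray's upper rate on some final window `[t₀, T)` of the Type-I blow-up. [folklore] -/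
theorem quarterLawTypeI_of_eventual
    (h : ∀ (ν T : ℝ), 0 < ν → 0 < T →
      ∀ (u : ℝ → EuclideanSpace ℝ (Fin 3) → EuclideanSpace ℝ (Fin 3))
        (p : ℝ → EuclideanSpace ℝ (Fin 3) → ℝ),
        IsMaximalSmoothSolution ν 0 u p T → IsLerayHopfOn T ν 0 (u 0) u →
        HasRapidSpatialDecay (u 0) → IsTypeIBlowup u T →
        ∃ K t₀ : ℝ, t₀ < T ∧ ∀ t ∈ Ico t₀ T,
          ∫⁻ x, ‖curl (u t) x‖ₑ ^ 2 ≤ ENNReal.ofReal (K / Real.sqrt (T - t))) :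
    QuarterLawTypeI := by
  intro ν T hν hT u p hmax hLH hdec hI
  exact quarterLaw_of_eventually hν hT hmax.1 hLH hdec (h ν T hν hT u p hmax hLH hdec hI)

open Summit.NavierStokesRegularity.NavierStokesRegularity.Theses.TypeIQuarterGate in
/-- Conversely (trivially) `QuarterLawTypeI` gives its eventual form. [folklore] -/
theorem eventual_of_quarterLawTypeI (h : QuarterLawTypeI) :
    ∀ (ν T : ℝ), 0 < ν → 0 < T →
      ∀ (u : ℝ → EuclideanSpace ℝ (Fin 3) → EuclideanSpace ℝ (Fin 3))
        (p : ℝ → EuclideanSpace ℝ (Fin 3) → ℝ),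
        IsMaximalSmoothSolution ν 0 u p T → IsLerayHopfOn T ν 0 (u 0) u →
        HasRapidSpatialDecay (u 0) → IsTypeIBlowup u T →
        ∃ K t₀ : ℝ, t₀ < T ∧ ∀ t ∈ Ico t₀ T,
          ∫⁻ x, ‖curl (u t) x‖ₑ ^ 2 ≤ ENNReal.ofReal (K / Real.sqrt (T - t)) := by
  intro ν T hν hT u p hmax hLH hdec hI
  obtain ⟨K, hK⟩ := h ν T hν hT u p hmax hLH hdec hI
  exact ⟨K, 0, hT, hK⟩

end LorentzOfEnvelope

end Summit.NavierStokesRegularity.NavierStokesRegularity.Theorems
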